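import Mathlib
import Summits.NavierStokesRegularity.NavierStokesRegularity.Theorems.ScenarioCensusHelicalSlabRadial
import Summits.NavierStokesRegularity.NavierStokesRegularity.Theorems.ScenarioCensusHelicalSlabEnergy
import Summits.NavierStokesRegularity.NavierStokesRegularity.Theorems.ScenarioCensusPeriodicSlabBounds
import HarnessLib

/-!
# Census row S6 (bounded helical steady flows): the weighted dyadic energy inequality

Support file for the scenario census of `NavierStokesRegularity` (cell `pub/ns-census`, block S,
row S6 = Han–Wang–Xie, arXiv:2312.10382, Thm 1.1; tree FACT
`Literature.Analysis.FluidPDE.HanWangXie2023_helical_liouville`). Printed proof, §3 (Step 2,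
"Saint-Venant type estimate"): every cut-off term of the energy identity (3.2) is bounded through
`‖u^r‖_{L²(𝒪_R)} ≤ C‖∂_z u^r‖_{L²(𝒪_R)}` (Poincaré, zero vertical means) and the bounds on `u`,
`∇u`, `∇P`. Here, on the dyadic annulus `{r ≤ ρ < 2r}` of one period `S = zSlab L 0` with the
cut-off `φ = cylCutoff r (2r)`, for every `r ≥ 1` and every splitting parameter `λ > 0`:

* `helical_dyadic_weighted_estimate` —
  `∫_S φ |DU|² ≤ a λ r + c (∫_S χ |DU|²)/(λ r)` with explicit `a, c` (depending on `sup ‖U‖`,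
  `sup ‖DP‖`, `L` and the cut-off constant), for a smooth steady solution at unit viscosity with
  `U`, `P` axially periodic and ZERO vertical period means of `⟪x_h, U⟫` (the helical input,
  `…HelicalSlabFlux`). The pressure term is split as `P = (P − P(x_h)) + P(x_h)`: the foot-point
  part integrates to zero against the radial cut-off term, the rest is `O(L ‖DP‖_∞)` — this
  replaces the Bogovskiĭ corrector `Ψ_{R,θ}` of the printed proof.

Inputs by name: `steady_window_identity` (`…HelicalSlabEnergy`), `radial_poincare_annulus`,
`cylCutoff_fderiv_radial`, `setIntegral_footPressure_mul_radial_eq_zero`, `abs_sub_footPressure_le`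
(`…HelicalSlabRadial`), `volume_zSlab_inter_cyl_le` (`…PeriodicSlabBounds`). Sequel:
`…HelicalSlabLiouville`. No summit statement and no census row is proved in this file.

## References

* J. Han, Y. Wang, C. Xie, arXiv:2312.10382 (2023), §3, (A126)–(A134). [HanWangXie2023]
-/

-- the summit and its single problem share the name (D-0017 nested layout)
set_option linter.dupNamespace false

noncomputable section

open MeasureTheory Set Function Filter InnerProductSpace
open scoped Topology ENNReal NNReal RealInnerProductSpace Laplacian ContDiff

namespace Summit.NavierStokesRegularity.NavierStokesRegularity.Theorems.ScenarioCensus.HelicalSlab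

open Literature.Analysis Literature.Analysis.FluidPDE
open Summit.NavierStokesRegularity.NavierStokesRegularity.Theorems.ScenarioCensus.PeriodicSlab

/-! ### Elementary algebra (kept outside the long proof) -/

/-- Young: `y ≤ (μ + y²/μ)/2` for `μ > 0`. -/
theorem young_abs_le (y : ℝ) {μ : ℝ} (hμ : 0 < μ) : |y| ≤ (μ + y ^ 2 / μ) / 2 := by
  have key : 0 ≤ (μ * 1 - |y|) ^ 2 / μ := by positivity
  rw [alg_sq_div μ 1 |y| hμ.ne', sq_abs] at key
  linarith

/-- Splitting of the radial dominating function. -/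
theorem alg_dom (c r χ μ w : ℝ) (hr : r ≠ 0) (hμ : μ ≠ 0) :
    c / r ^ 2 * χ * ((μ + w ^ 2 / μ) / 2) =
      c * μ / (2 * r ^ 2) * χ + c / (2 * μ * r ^ 2) * (χ * w ^ 2) := by
  field_simp

/-- Collecting the radial bound. -/
theorem alg_rad (c L κ D r lam : ℝ) (hr : r ≠ 0) (hlam : lam ≠ 0) :
    c * (lam * r) / (2 * r ^ 2) * (32 * L * r ^ 2) +
        c / (2 * (lam * r) * r ^ 2) * (κ * ((2 * r) ^ 2 * D)) =
      16 * c * L * lam * r + 2 * c * κ * D / (lam * r) := by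
  field_simp
  ring

/-- Collecting the Green-term bound. -/
theorem alg_green (C₀ M L D r lam : ℝ) (hr : r ≠ 0) (hlam : lam ≠ 0) :
    C₀ * M * lam / r * (32 * L * r ^ 2) + C₀ * M / (r * lam) * D =
      32 * C₀ * M * L * lam * r + C₀ * M * D / (lam * r) := by
  field_simp

/-! ### The estimate -/

/-- **The weighted dyadic energy inequality for bounded periodic steady flows with mean-free
radial velocity** (Han–Wang–Xie, §3 Step 2, on the dyadic annulus `{r ≤ ρ < 2r}`). Let `(U, P)` be
a smooth steady solution at unit viscosity (`IsLerayProfile 1 0 U P`, `U, P ∈ C^∞`), both axially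
`L`-periodic (`L > 0`), with `‖U‖ ≤ M`, `‖DP‖ ≤ K₃`, `|DU|² ≤ B`, and with ZERO vertical period
means of `⟪x_h, U⟫`; let `C₀` be the gradient constant of the cylindrical cut-offs. Then for
`r ≥ 1`, `λ > 0`, with `φ = cylCutoff r (2r)`, `χ = 𝟙{r ≤ ρ < 2r}`, `κ = (L/(2π))²`, `S = zSlab L 0`:
`∫_S φ|DU|² ≤ (96 C₀ M L + 8 C₀ M² L + 16 C₀ K₃ L²) λ r + (3 C₀ M + C₀ M² κ + 2 C₀ K₃ L κ) (∫_S χ|DU|²)/(λ r)`. -/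
theorem helical_dyadic_weighted_estimate {L M K₃ B C₀ : ℝ} (hL : 0 < L)
    {U : EuclideanSpace ℝ (Fin 3) → EuclideanSpace ℝ (Fin 3)} {P : EuclideanSpace ℝ (Fin 3) → ℝ}
    (h : IsLerayProfile 1 0 U P) (hU : ContDiff ℝ (⊤ : ℕ∞) U) (hP : ContDiff ℝ (⊤ : ℕ∞) P)
    (hUper : IsAxiallyPeriodic L U) (hPper : IsAxiallyPeriodic L P)
    (hM : ∀ x, ‖U x‖ ≤ M) (hK₃ : ∀ x, ‖fderiv ℝ P x‖ ≤ K₃)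
    (hB : ∀ x, frobeniusNormSq (fderiv ℝ U x) ≤ B)
    (hmean : ∀ x, ∫ s in (0 : ℝ)..L, ⟪horizPart x, U (x + s • eZ)⟫ = 0)
    (hC₀ : ∀ (ρ₂ ρ₁ : ℝ), 0 ≤ ρ₂ → ρ₂ < ρ₁ → ∀ x : EuclideanSpace ℝ (Fin 3),
      ‖gradient (cylCutoff ρ₂ ρ₁) x‖ ≤ C₀ / (ρ₁ - ρ₂))
    {r : ℝ} (hr : 1 ≤ r) {lam : ℝ} (hlam : 0 < lam) :
    ∫ x in zSlab L 0, cylCutoff r (2 * r) x * frobeniusNormSq (fderiv ℝ U x) ≤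
      (96 * C₀ * M * L + 8 * C₀ * M ^ 2 * L + 16 * C₀ * K₃ * L ^ 2) * lam * r +
        (3 * C₀ * M + C₀ * M ^ 2 * (L / (2 * Real.pi)) ^ 2 +
            2 * C₀ * K₃ * L * (L / (2 * Real.pi)) ^ 2) *
          (∫ x in zSlab L 0,
            {x | r ≤ cylRadius x ∧ cylRadius x < 2 * r}.indicator (fun _ => (1 : ℝ)) x *
              frobeniusNormSq (fderiv ℝ U x)) / (lam * r) := by
  set b := EuclideanSpace.basisFun (Fin 3) ℝ with hb
  set S : Set (EuclideanSpace ℝ (Fin 3)) := zSlab L 0 with hS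
  set F : EuclideanSpace ℝ (Fin 3) → ℝ := fun x => frobeniusNormSq (fderiv ℝ U x) with hF
  set ur : EuclideanSpace ℝ (Fin 3) → ℝ := fun x => ⟪horizPart x, U x⟫ with hur
  set κ : ℝ := (L / (2 * Real.pi)) ^ 2 with hκ
  have hκ0 : 0 ≤ κ := sq_nonneg _
  have hr0 : 0 < r := by linarith
  have hr2 : r < 2 * r := by linarith
  have hU1 : ContDiff ℝ 1 U := contDiff_infty.1 hU 1
  have hUc : Continuous U := hU1.continuous
  have hUd : Differentiable ℝ U := hU1.differentiable one_ne_zero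
  have hPc : Continuous P := hP.continuous
  have hPd : Differentiable ℝ P := (contDiff_infty.1 hP 1).differentiable one_ne_zero
  have hDUc : Continuous (fderiv ℝ U) := hU1.continuous_fderiv one_ne_zero
  have hFc : Continuous F := continuous_frobeniusNormSq_fderiv hU1 one_ne_zero
  have hurc : Continuous ur := horizPart.continuous.inner hUc
  have hF0 : ∀ x, 0 ≤ F x := fun x => frobeniusNormSq_nonneg _
  have hM0 : 0 ≤ M := (norm_nonneg _).trans (hM 0)
  have hK₃0 : 0 ≤ K₃ := (norm_nonneg _).trans (hK₃ 0)
  have hdi : ∀ x i, ‖fderiv ℝ U x (b i)‖ ^ 2 ≤ F x := fun x i => norm_apply_sq_le_frobeniusNormSq b _ i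
  -- the cut-off, its radial structure, and the annulus
  set φ : EuclideanSpace ℝ (Fin 3) → ℝ := cylCutoff r (2 * r) with hφ
  have hφ2 : ContDiff ℝ 2 φ := contDiff_cylCutoff r (2 * r)
  have hφ1 : ContDiff ℝ 1 φ := contDiff_cylCutoff r (2 * r)
  have hφc : Continuous φ := hφ2.continuous
  have hDφc : Continuous (fderiv ℝ φ) := hφ1.continuous_fderiv one_ne_zero
  have hφnn : ∀ x, 0 ≤ φ x := cylCutoff_nonneg r (2 * r)
  have hφzero : ∀ x, 2 * r ≤ cylRadius x → φ x = 0 := fun x hx => cylCutoff_eq_zero hr0.le hr2 hx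
  have hφper : IsAxiallyPeriodic L φ := isAxiallyPeriodic_cylCutoff L r (2 * r)
  obtain ⟨a, ha, haz, ha0, hDφa0, hDφle0⟩ := cylCutoff_fderiv_radial hr0 hC₀
  have hDφa : ∀ x v, fderiv ℝ φ x v = a x * ⟪horizPart x, v⟫ := hDφa0
  have hDφle : ∀ x v, |fderiv ℝ φ x v| ≤
      C₀ / r ^ 2 * {x | r ≤ cylRadius x ∧ cylRadius x < 2 * r}.indicator (fun _ => (1 : ℝ)) x *
        |⟪horizPart x, v⟫| := hDφle0
  have hac : Continuous a := ha.continuous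
  have hC₀0 : 0 ≤ C₀ := by
    have h1 := hC₀ r (2 * r) hr0.le hr2 0
    rw [show 2 * r - r = r by ring] at h1
    have h2 : 0 ≤ C₀ / r := (norm_nonneg _).trans h1
    by_contra hneg
    exact absurd h2 (not_le.2 (div_neg_of_neg_of_pos (not_le.1 hneg) hr0))
  set A : Set (EuclideanSpace ℝ (Fin 3)) := {x | r ≤ cylRadius x ∧ cylRadius x < 2 * r} with hA
  have hAm : MeasurableSet A :=
    (isClosed_le continuous_const continuous_cylRadius).measurableSet.inter
      (isOpen_lt continuous_cylRadius continuous_const).measurableSet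
  set χ : EuclideanSpace ℝ (Fin 3) → ℝ := A.indicator fun _ => (1 : ℝ) with hχ
  have hχm : Measurable χ := measurable_const.indicator hAm
  have hχnn : ∀ x, 0 ≤ χ x := fun x => Set.indicator_nonneg (fun _ _ => zero_le_one) x
  have hχle : ∀ x, χ x ≤ 1 := fun x => Set.indicator_le_self' (fun _ _ => zero_le_one) x
  have hχzero : ∀ x, 2 * r ≤ cylRadius x → χ x = 0 := fun x hx => by
    simp only [hχ, Set.indicator_apply, hA, mem_setOf_eq]
    rw [if_neg]; exact fun h' => absurd h'.2 (not_lt.2 hx)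
  -- `|∂ᵢφ| ≤ (2C₀/r) χ`
  have hDφi : ∀ x i, |fderiv ℝ φ x (b i)| ≤ 2 * C₀ / r * χ x := by
    intro x i
    have hle := hDφle x (b i)
    by_cases hx : x ∈ A
    · have hχ1 : χ x = 1 := by simp [hχ, hx]
      rw [hχ1, mul_one] at hle ⊢
      have h1 : |⟪horizPart x, b i⟫| ≤ 2 * r := by
        calc |⟪horizPart x, b i⟫| ≤ ‖horizPart x‖ * ‖b i‖ := abs_real_inner_le_norm _ _
          _ ≤ 2 * r := by rw [b.orthonormal.1 i, mul_one, norm_horizPart]; exact hx.2.le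
      calc |fderiv ℝ φ x (b i)| ≤ C₀ / r ^ 2 * |⟪horizPart x, b i⟫| := hle
        _ ≤ C₀ / r ^ 2 * (2 * r) := mul_le_mul_of_nonneg_left h1 (div_nonneg hC₀0 (sq_nonneg _))
        _ = 2 * C₀ / r := by field_simp
    · have hχ0 : χ x = 0 := by simp [hχ, hx]
      rw [hχ0, mul_zero] at hle ⊢
      simpa using hle
  -- the identity per period
  have hid := steady_window_identity hL h hU hP hUper hPper hφ2 hφper hφnn hφzero
  -- the integrals
  set Iφ : ℝ := ∫ x in S, φ x * F x with hIφ
  set D : ℝ := ∫ x in S, χ x * F x with hD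
  set V : ℝ := ∫ x in S, χ x with hVdef
  set J : ℝ := ∫ x in S, χ x * ur x ^ 2 with hJdef
  -- integrability on the slab
  have hχ_int : IntegrableOn χ S volume :=
    integrableOn_zSlab_of_bound hL hχm.aestronglyMeasurable (ρ := 2 * r) hχzero (B := 1)
      fun x _ => by rw [Real.norm_eq_abs, abs_of_nonneg (hχnn x)]; exact hχle x
  have hB0 : 0 ≤ B := (hF0 0).trans (hB 0)
  have hD_int : IntegrableOn (fun x => χ x * F x) S volume := by
    refine integrableOn_zSlab_of_bound hL ((hχm.mul hFc.measurable).aestronglyMeasurable)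
      (ρ := 2 * r) (fun x hx => by rw [hχzero x hx, zero_mul]) (B := B) fun x _ => ?_
    rw [Real.norm_eq_abs, abs_mul, abs_of_nonneg (hχnn x), abs_of_nonneg (hF0 x)]
    exact (mul_le_mul (hχle x) (hB x) (hF0 x) zero_le_one).trans (by rw [one_mul])
  obtain ⟨Bu, hBu⟩ := (isCompact_closedBall (0 : EuclideanSpace ℝ (Fin 3)) (|2 * r| + L)).exists_bound_of_continuousOn
    (hurc.pow 2).continuousOn
  have hJ_int : IntegrableOn (fun x => χ x * ur x ^ 2) S volume := by
    refine integrableOn_zSlab_of_bound hL ((hχm.mul (hurc.pow 2).measurable).aestronglyMeasurable)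
      (ρ := 2 * r) (fun x hx => by rw [hχzero x hx, zero_mul]) (B := Bu) fun x hx => ?_
    rw [Real.norm_eq_abs, abs_mul, abs_of_nonneg (hχnn x)]
    have h1 : |ur x ^ 2| ≤ Bu := by
      rw [← Real.norm_eq_abs]; exact hBu x (mem_closedBall_zero_iff.2 hx)
    exact (mul_le_mul (hχle x) h1 (abs_nonneg _) zero_le_one).trans (by rw [one_mul])
  have hD0 : 0 ≤ D := setIntegral_nonneg (measurableSet_zSlab L 0) fun x _ => mul_nonneg (hχnn x) (hF0 x)
  -- volume of the annulus period and the radial Poincaré inequality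
  have hV : V ≤ 32 * L * r ^ 2 := by
    have h1 : V = volume.real (S ∩ A) := by
      rw [hVdef, hχ, setIntegral_indicator hAm, setIntegral_const, smul_eq_mul, mul_one]
    rw [h1, measureReal_def]
    refine ENNReal.toReal_le_of_le_ofReal (by positivity) ?_
    calc volume (S ∩ A) ≤ volume (zSlab L 0 ∩ {x | cylRadius x < 2 * r}) :=
          measure_mono fun x hx => ⟨hx.1, hx.2.2⟩
      _ ≤ ENNReal.ofReal (8 * L * (2 * r) ^ 2) := volume_zSlab_inter_cyl_le hL (by linarith)
      _ = ENNReal.ofReal (32 * L * r ^ 2) := by ring_nf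
  have hJ : J ≤ κ * ((2 * r) ^ 2 * D) := radial_poincare_annulus hL hr0 hU1 hUper hB hmean
  -- the generic radial bound: `|g| ≤ (c/r²) χ |ur|` on `S` ⇒ `|∫_S g| ≤ 16 c L λ r + 2 c κ D/(λ r)`
  have hrad : ∀ c : ℝ, 0 ≤ c → ∀ g : EuclideanSpace ℝ (Fin 3) → ℝ, IntegrableOn g S volume →
      (∀ x ∈ S, |g x| ≤ c / r ^ 2 * χ x * |ur x|) →
      |∫ x in S, g x| ≤ 16 * c * L * lam * r + 2 * c * κ * D / (lam * r) := by
    intro c hc g hgi hgb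
    set μ : ℝ := lam * r with hμdef
    have hμ : 0 < μ := mul_pos hlam hr0
    have hdom_int : IntegrableOn
        (fun x => c * μ / (2 * r ^ 2) * χ x + c / (2 * μ * r ^ 2) * (χ x * ur x ^ 2)) S volume :=
      (hχ_int.const_mul _).add (hJ_int.const_mul _)
    have h1 := norm_integral_le_of_norm_le (μ := volume.restrict S) hdom_int
      ((ae_restrict_iff' (measurableSet_zSlab L 0)).2 (Eventually.of_forall fun x hx => (?_ :
        ‖g x‖ ≤ c * μ / (2 * r ^ 2) * χ x + c / (2 * μ * r ^ 2) * (χ x * ur x ^ 2))))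
    · rw [Real.norm_eq_abs] at h1
      have h2 : ∫ x in S, (c * μ / (2 * r ^ 2) * χ x + c / (2 * μ * r ^ 2) * (χ x * ur x ^ 2)) =
          c * μ / (2 * r ^ 2) * V + c / (2 * μ * r ^ 2) * J := by
        rw [integral_add (hχ_int.const_mul _) (hJ_int.const_mul _), integral_const_mul,
          integral_const_mul]
      rw [h2] at h1
      have h3 : c * μ / (2 * r ^ 2) * V ≤ c * μ / (2 * r ^ 2) * (32 * L * r ^ 2) :=
        mul_le_mul_of_nonneg_left hV (by positivity)
      have h4 : c / (2 * μ * r ^ 2) * J ≤ c / (2 * μ * r ^ 2) * (κ * ((2 * r) ^ 2 * D)) :=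
        mul_le_mul_of_nonneg_left hJ (by positivity)
      have e := alg_rad c L κ D r lam hr0.ne' hlam.ne'
      rw [← hμdef] at e
      linarith
    · rw [Real.norm_eq_abs]
      have hy := young_abs_le (ur x) hμ
      have h5 : 0 ≤ c / r ^ 2 * χ x := mul_nonneg (div_nonneg hc (sq_nonneg _)) (hχnn x)
      calc |g x| ≤ c / r ^ 2 * χ x * |ur x| := hgb x hx
        _ ≤ c / r ^ 2 * χ x * ((μ + ur x ^ 2 / μ) / 2) := mul_le_mul_of_nonneg_left hy h5
        _ = c * μ / (2 * r ^ 2) * χ x + c / (2 * μ * r ^ 2) * (χ x * ur x ^ 2) :=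
            alg_dom c r (χ x) μ (ur x) hr0.ne' hμ.ne'
  -- T1: the Green terms
  have hT1 : ∀ i, |∫ x in S, fderiv ℝ φ x (b i) * ⟪fderiv ℝ U x (b i), U x⟫| ≤
      32 * C₀ * M * L * lam * r + C₀ * M * D / (lam * r) := by
    intro i
    have hdom_int : IntegrableOn
        (fun x => C₀ * M * lam / r * χ x + C₀ * M / (r * lam) * (χ x * F x)) S volume :=
      (hχ_int.const_mul _).add (hD_int.const_mul _)
    have h1 := norm_integral_le_of_norm_le (μ := volume.restrict S) hdom_int
      (Eventually.of_forall fun x => (?_ :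
        ‖fderiv ℝ φ x (b i) * ⟪fderiv ℝ U x (b i), U x⟫‖ ≤
          C₀ * M * lam / r * χ x + C₀ * M / (r * lam) * (χ x * F x)))
    · rw [Real.norm_eq_abs] at h1
      have h2 : ∫ x in S, (C₀ * M * lam / r * χ x + C₀ * M / (r * lam) * (χ x * F x)) =
          C₀ * M * lam / r * V + C₀ * M / (r * lam) * D := by
        rw [integral_add (hχ_int.const_mul _) (hD_int.const_mul _), integral_const_mul,
          integral_const_mul]
      rw [h2] at h1
      have h3 : C₀ * M * lam / r * V ≤ C₀ * M * lam / r * (32 * L * r ^ 2) :=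
        mul_le_mul_of_nonneg_left hV (by positivity)
      have e := alg_green C₀ M L D r lam hr0.ne' hlam.ne'
      linarith
    · rw [norm_mul, Real.norm_eq_abs]
      have h2 := hDφi x i
      have h3 : ‖⟪fderiv ℝ U x (b i), U x⟫‖ ≤ ‖fderiv ℝ U x (b i)‖ * M :=
        (norm_inner_le_norm _ _).trans (mul_le_mul_of_nonneg_left (hM x) (norm_nonneg _))
      have hy : ‖fderiv ℝ U x (b i)‖ ≤ (lam + ‖fderiv ℝ U x (b i)‖ ^ 2 / lam) / 2 := by
        have := young_abs_le ‖fderiv ℝ U x (b i)‖ hlam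
        rwa [abs_of_nonneg (norm_nonneg _)] at this
      have hy' : ‖fderiv ℝ U x (b i)‖ ≤ (lam + F x / lam) / 2 :=
        hy.trans (by
          have := div_le_div_of_nonneg_right (hdi x i) hlam.le
          linarith)
      have h5 : 0 ≤ 2 * C₀ / r * χ x := mul_nonneg (by positivity) (hχnn x)
      calc |fderiv ℝ φ x (b i)| * ‖⟪fderiv ℝ U x (b i), U x⟫‖
          ≤ (2 * C₀ / r * χ x) * (‖fderiv ℝ U x (b i)‖ * M) := mul_le_mul h2 h3 (norm_nonneg _) h5
        _ = (2 * C₀ / r * χ x * M) * ‖fderiv ℝ U x (b i)‖ := by ring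
        _ ≤ (2 * C₀ / r * χ x * M) * ((lam + F x / lam) / 2) :=
            mul_le_mul_of_nonneg_left hy' (mul_nonneg h5 hM0)
        _ = C₀ * M * lam / r * χ x + C₀ * M / (r * lam) * (χ x * F x) := by
            field_simp
  have hT1s : |∑ i, ∫ x in S, fderiv ℝ φ x (b i) * ⟪fderiv ℝ U x (b i), U x⟫| ≤
      3 * (32 * C₀ * M * L * lam * r) + 3 * (C₀ * M * D / (lam * r)) := by
    refine (Finset.abs_sum_le_sum_abs _ _).trans ?_
    calc ∑ i, |∫ x in S, fderiv ℝ φ x (b i) * ⟪fderiv ℝ U x (b i), U x⟫|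
        ≤ ∑ _i : Fin 3, (32 * C₀ * M * L * lam * r + C₀ * M * D / (lam * r)) :=
          Finset.sum_le_sum fun i _ => hT1 i
      _ = 3 * (32 * C₀ * M * L * lam * r) + 3 * (C₀ * M * D / (lam * r)) := by simp
  -- T2: the cubic term
  have hT2_int : IntegrableOn (fun x => fderiv ℝ φ x (U x) * ‖U x‖ ^ 2) S volume :=
    integrableOn_zSlab_of_eq_zero_of_le_cylRadius (Q := fun x => fderiv ℝ φ x (U x) * ‖U x‖ ^ 2)
      ((hDφc.clm_apply hUc).mul (hUc.norm.pow 2))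
      (fun x hx => by show fderiv ℝ φ x (U x) * ‖U x‖ ^ 2 = 0; rw [hDφa x (U x), ha0 x hx, zero_mul, zero_mul]) L 0
  have hT2 : |∫ x in S, fderiv ℝ φ x (U x) * ‖U x‖ ^ 2| ≤
      16 * (C₀ * M ^ 2) * L * lam * r + 2 * (C₀ * M ^ 2) * κ * D / (lam * r) := by
    refine hrad (C₀ * M ^ 2) (by positivity) _ hT2_int fun x _ => ?_
    rw [abs_mul, abs_of_nonneg (sq_nonneg ‖U x‖)]
    have h1 := hDφle x (U x)
    have h2 : ‖U x‖ ^ 2 ≤ M ^ 2 := pow_le_pow_left₀ (norm_nonneg _) (hM x) 2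
    have h5 : 0 ≤ C₀ / r ^ 2 * χ x * |ur x| :=
      mul_nonneg (mul_nonneg (div_nonneg hC₀0 (sq_nonneg _)) (hχnn x)) (abs_nonneg _)
    calc |fderiv ℝ φ x (U x)| * ‖U x‖ ^ 2 ≤ (C₀ / r ^ 2 * χ x * |ur x|) * M ^ 2 :=
          mul_le_mul h1 h2 (sq_nonneg _) h5
      _ = C₀ * M ^ 2 / r ^ 2 * χ x * |ur x| := by ring
  -- T3: the pressure term, split at the foot point
  have hT3a_int : IntegrableOn (fun x => (P x - P (horizPart x)) * fderiv ℝ φ x (U x)) S volume :=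
    integrableOn_zSlab_of_eq_zero_of_le_cylRadius (Q := fun x => (P x - P (horizPart x)) * fderiv ℝ φ x (U x))
      ((hPc.sub (hPc.comp horizPart.continuous)).mul (hDφc.clm_apply hUc))
      (fun x hx => by
        show (P x - P (horizPart x)) * fderiv ℝ φ x (U x) = 0
        rw [hDφa x (U x), ha0 x hx, zero_mul, mul_zero]) L 0
  have hT3b_int : IntegrableOn (fun x => (P (horizPart x) * a x) * ur x) S volume :=
    integrableOn_zSlab_of_eq_zero_of_le_cylRadius (Q := fun x => (P (horizPart x) * a x) * ur x)
      (((hPc.comp horizPart.continuous).mul hac).mul hurc)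
      (fun x hx => by show (P (horizPart x) * a x) * ur x = 0; rw [ha0 x hx, mul_zero, zero_mul]) L 0
  have hT3eq : ∫ x in S, P x * fderiv ℝ φ x (U x) =
      (∫ x in S, (P x - P (horizPart x)) * fderiv ℝ φ x (U x)) +
        ∫ x in S, (P (horizPart x) * a x) * ur x := by
    rw [← integral_add hT3a_int hT3b_int]
    refine setIntegral_congr_fun (measurableSet_zSlab L 0) fun x _ => ?_
    simp only [hur, hDφa x (U x)]
    ring
  have hT3b : ∫ x in S, (P (horizPart x) * a x) * ur x = 0 :=
    setIntegral_footPressure_mul_radial_eq_zero hL hr0 hac haz ha0 hPc hUc hUper hmean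
  have hT3a : |∫ x in S, (P x - P (horizPart x)) * fderiv ℝ φ x (U x)| ≤
      16 * (C₀ * K₃ * L) * L * lam * r + 2 * (C₀ * K₃ * L) * κ * D / (lam * r) := by
    refine hrad (C₀ * K₃ * L) (by positivity) _ hT3a_int fun x hx => ?_
    rw [abs_mul]
    have h1 : |P x - P (horizPart x)| ≤ K₃ * L := abs_sub_footPressure_le hPd hK₃ hx
    have h2 := hDφle x (U x)
    have h5 : 0 ≤ C₀ / r ^ 2 * χ x * |ur x| :=
      mul_nonneg (mul_nonneg (div_nonneg hC₀0 (sq_nonneg _)) (hχnn x)) (abs_nonneg _)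
    calc |P x - P (horizPart x)| * |fderiv ℝ φ x (U x)| ≤ (K₃ * L) * (C₀ / r ^ 2 * χ x * |ur x|) :=
          mul_le_mul h1 h2 (abs_nonneg _) (mul_nonneg hK₃0 hL.le)
      _ = C₀ * K₃ * L / r ^ 2 * χ x * |ur x| := by ring
  -- assemble
  have hmain : Iφ = -(∑ i, ∫ x in S, fderiv ℝ φ x (b i) * ⟪fderiv ℝ U x (b i), U x⟫) +
      2⁻¹ * (∫ x in S, fderiv ℝ φ x (U x) * ‖U x‖ ^ 2) +
      ∫ x in S, P x * fderiv ℝ φ x (U x) := hid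
  rw [hT3eq, hT3b, add_zero] at hmain
  have a1 := (abs_le.1 hT1s).1
  have a2 := (abs_le.1 hT2).2
  have a3 := (abs_le.1 hT3a).2
  have e : 3 * (32 * C₀ * M * L * lam * r) + 3 * (C₀ * M * D / (lam * r)) +
      2⁻¹ * (16 * (C₀ * M ^ 2) * L * lam * r + 2 * (C₀ * M ^ 2) * κ * D / (lam * r)) +
      (16 * (C₀ * K₃ * L) * L * lam * r + 2 * (C₀ * K₃ * L) * κ * D / (lam * r)) =
      (96 * C₀ * M * L + 8 * C₀ * M ^ 2 * L + 16 * C₀ * K₃ * L ^ 2) * lam * r +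
        (3 * C₀ * M + C₀ * M ^ 2 * κ + 2 * C₀ * K₃ * L * κ) * D / (lam * r) := by ring
  have hfin : Iφ ≤ 3 * (32 * C₀ * M * L * lam * r) + 3 * (C₀ * M * D / (lam * r)) +
      2⁻¹ * (16 * (C₀ * M ^ 2) * L * lam * r + 2 * (C₀ * M ^ 2) * κ * D / (lam * r)) +
      (16 * (C₀ * K₃ * L) * L * lam * r + 2 * (C₀ * K₃ * L) * κ * D / (lam * r)) := by
    rw [hmain]; linarith
  rw [← e]
  exact hfin

end Summit.NavierStokesRegularity.NavierStokesRegularity.Theorems.ScenarioCensus.HelicalSlab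

end
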